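/- Copyright: ym3-torus cell, WIDTH-5 ATTACH seat `ym-ust-19936-w4` (prover, g10), for crux `HistoryTailL` (stmt-QuantumFields-19936),
level-0 prefactor-free infrastructure (the `gibbsMeasure`∕`T3Family` reading) of LINE `local_insertion` (#13) ∕ K1.  Released under the
licence of the surrounding project. -/
import Summits.QuantumFields.YangMills.Theorems.LocalInsertionExpMomentSU2Torus
import Literature.MathematicalPhysics.QuantumFieldTheory.Balaban1983to89.T3FinestHeightTail
import HarnessLib

/-!
# The prefactor-free single-plaquette tail on Bałaban's three-tori: the `gibbsMeasure` reading of (EM)∕(GT)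

Support file (`--supports stmt-QuantumFields-19936 --as helper`).  ✓`LocalInsertionExpMomentSU2Torus` proves the prefactor-free
tail (GT) for the host tree's Wilson measure `wilsonMeasure (fundamentalRep (Fin 2)) β` on `GaugeConfig 3 n SU(2)`, for plaquettes of
the reference orientation `(c₀; 0, a)`.  Here it is read on the cell's carriers through the dictionary of ✓`T3FinestHeightTail`
(`gibbsMeasure_real_eq_wilsonMeasure_real`: Bałaban's Gibbs measure `T4GenFunBounds.gibbsMeasure P β` at un-normalised coupling is the
host Wilson measure at `β∕2`) and the lattice symmetry ✓`FariaDaVeigaOCarroll2022.integral_plaquette_eq_of_symmetry` (every plaquette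
has the law of a reference-orientation one):

* **`exists_gibbsMeasure_real_dist1_ge_le_T3`** — there is `C > 0` with, for every `T3Family F`, cut-off `K`, `0 ≤ λ < 1`, `β` with
  `(1−λ)β ≥ 2`, `θ ≥ 0` and EVERY plaquette `p` of the finest torus `T^{(0)}_K` (`n = sitesPerDir 0 = 2L^{m+K}` sites a side):
  `(gibbsMeasure (F.P K) β){U : θ ≤ dist1 U(∂p)} ≤ C·((1−λ)⁻¹)³·(β∕2)^{3(n²+n+1)∕(2n³)}·exp(−λ(β∕2)θ²∕2)` —
  the twin of ✓`T3FinestHeightTail.gibbsMeasure_real_dist1_ge_le` (`2e^{24}c^{−3}·(√β)⁹·e^{−βθ²∕4}` at `d = 3`, `N = 2`) with the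
  volume-entropy power `(√β)⁹` replaced by `(β∕2)^{3(n²+n+1)∕(2n³)} ≤ (β∕2)^{9∕(2n)}`;
* **`exists_gibbsK_real_dist1_ge_le`** — the same for the tower laws `gibbsK F ℰ γ K` (`β := (F.scheme ℰ γ).β K`).

HONEST SCOPE ∕ CAVEAT (LEAD ★w1-19936 g7).  A tail of ONE bare plaquette; the residual `(β∕2)^{3(n²+n+1)∕(2n³)}` is NOT γ-uniform at
fixed small `K` (`log β_K ∕ n_K ∋ log γ⁻¹∕(2L^{m+K})`), so this is NOT `stub_insertionHeightOne` and is never to be worded as it; every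
consumer of record absorbs the residual through `b₀` (`HistoryTailL`'s `∃ b₀ ≥ b₁`).  Nothing of heights `j ≥ 1`, of LINE #13's stubs, of
`HistoryTailL` or of any crux is proved.  YM₃ on T³ is rung R3 — not d = 4, not infinite volume, not a mass gap, not Clay.
-/

namespace Summit.QuantumFields.YangMills.Theorems.LocalInsertion.ExpMomentSU2T3

open MeasureTheory Real
open scoped Matrix.Norms.L2Operator ENNReal
open Literature.MathematicalPhysics.QuantumFieldTheory
open Literature.MathematicalPhysics.QuantumFieldTheory.Balaban1983to89
open Literature.MathematicalPhysics.QuantumFieldTheory.Balaban1983to89.T3ContinuumYM3Torus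
open Literature.MathematicalPhysics.QuantumFieldTheory.Balaban1983to89.T3UnitScaleTilt
open Literature.MathematicalPhysics.QuantumLattice (fundamentalRep fundamentalRep_apply continuous_fundamentalRep)
open Summit.QuantumFields.YangMills.Theorems.LocalInsertion.ExpMomentSU2 (exists_measureReal_largePlaquette_su2_le)

noncomputable section

/-- The finest torus of the `K`-th approximation has at least two (in fact `2L^{m+K} ≥ 54`) sites a side. [folklore] -/
theorem one_lt_sitesPerDir (F : T3Family) (K : ℕ) : 1 < (F.P K).sitesPerDir 0 := by
  rw [show (F.P K).sitesPerDir 0 = 2 * F.L ^ (F.m + K - 0) from rfl]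
  have hL : 1 ≤ F.L := le_of_lt F.hL.2
  have : 1 ≤ F.L ^ (F.m + K - 0) := Nat.one_le_pow _ _ hL
  omega

/-- ★★★ **THE PREFACTOR-FREE SINGLE-PLAQUETTE TAIL ON BAŁABAN'S THREE-TORI.**  There is `C > 0` such that for every `T3Family F`,
every cut-off `K`, every `0 ≤ λ < 1` and `β` with `2 ≤ (1 − λ)β`, every `θ ≥ 0` and every plaquette `p` of `T^{(0)}_K`
(`n := (F.P K).sitesPerDir 0`):
`(gibbsMeasure (F.P K) β).real {U | θ ≤ dist1 (U(∂p))} ≤ C·((1−λ)⁻¹)³·(β∕2)^{3(n²+n+1)∕(2n³)}·exp(−(λ·(β∕2)·θ²∕2))`.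
(Bridge ✓`gibbsMeasure_real_eq_wilsonMeasure_real` at `N = 2`, lattice symmetry ✓`integral_plaquette_eq_of_symmetry`, then
✓`ExpMomentSU2.exists_measureReal_largePlaquette_su2_le`.) [cite: Chatterjee2016, Thm. 2.1; FrohlichIsraelLiebSimon1978, Thm. 4.1; Balaban1985UV3, (11) p.258] -/
theorem exists_gibbsMeasure_real_dist1_ge_le_T3 :
    ∃ C : ℝ, 0 < C ∧ ∀ (F : T3Family) (K : ℕ) (β lam : ℝ), 0 ≤ lam → lam < 1 → 2 ≤ (1 - lam) * β →
      ∀ (θ : ℝ), 0 ≤ θ → ∀ p : Plaq (F.P K) 0,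
        (T4GenFunBounds.gibbsMeasure (F.P K) β).real
            {U : GaugeField (F.P K) 0 (Matrix.specialUnitaryGroup (Fin 2) ℂ) | θ ≤ dist1 (GaugeField.plaqHol U p)} ≤
          C * ((1 - lam)⁻¹) ^ 3 *
              (β / 2) ^ (3 * ((((F.P K).sitesPerDir 0 : ℕ) : ℝ) ^ 2 + ((F.P K).sitesPerDir 0 : ℕ) + 1) /
                (2 * (((F.P K).sitesPerDir 0 : ℕ) : ℝ) ^ 3)) *
            Real.exp (-(lam * (β / 2) * θ ^ 2 / 2)) := by
  obtain ⟨C, hC, hGT⟩ := exists_measureReal_largePlaquette_su2_le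
  refine ⟨C, hC, fun F K β lam hlam0 hlam1 hβ θ hθ p => ?_⟩
  set ρ := fundamentalRep (Fin 2) with hρdef
  have hρc : Continuous ρ := continuous_fundamentalRep (Fin 2)
  have h1l : 0 < 1 - lam := by linarith
  have hβ0 : 0 < β := by
    have : 0 < (1 - lam) * β := by linarith
    exact (mul_pos_iff_of_pos_left h1l).1 this
  have hβ2 : 1 ≤ (1 - lam) * (β / 2) := by linarith
  -- the event and its measurability on both carriers
  set E : Set (Matrix.specialUnitaryGroup (Fin 2) ℂ) := {g | θ ≤ dist1 g} with hE
  have hEm : MeasurableSet E := measurableSet_le measurable_const RegularGaugeGroup.measurable_dist1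
  have hSm : MeasurableSet {U : GaugeField (F.P K) 0 (Matrix.specialUnitaryGroup (Fin 2) ℂ) | θ ≤ dist1 (GaugeField.plaqHol U p)} :=
    measurableSet_le measurable_const (RegularGaugeGroup.measurable_dist1.comp (Missing.measurable_plaqHol p))
  -- the dictionary: Bałaban's Gibbs measure at `β` = the host Wilson measure at `β ∕ 2`
  set x : Literature.MathematicalPhysics.QuantumFieldTheory.Site (F.P K).d ((F.P K).sitesPerDir 0) := p.src with hx
  have hpre : (ofConfig (P := F.P K) (j := 0)) ⁻¹'
        {U : GaugeField (F.P K) 0 (Matrix.specialUnitaryGroup (Fin 2) ℂ) | θ ≤ dist1 (GaugeField.plaqHol U p)} =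
      {V : GaugeConfig (F.P K).d ((F.P K).sitesPerDir 0) (Matrix.specialUnitaryGroup (Fin 2) ℂ) |
        plaquetteHolonomy V x p.μ p.ν ∈ E} := by
    ext V
    simp only [Set.mem_preimage, Set.mem_setOf_eq, hE, hx]
    rw [← plaquetteHolonomy_toConfig (ofConfig V) p, toConfig_ofConfig]
  rw [T3FinestHeightTail.gibbsMeasure_real_eq_wilsonMeasure_real (F.P K) (N := 2) hβ0.le hSm, hpre]
  have hN : β / ((2 : ℕ) : ℝ) = β / 2 := by norm_num
  rw [hN]
  -- lattice symmetry: the plaquette `(x; μ, ν)` has the law of `(x; 0, ν)`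
  haveI : Fact (1 < (F.P K).sitesPerDir 0) := ⟨one_lt_sitesPerDir F K⟩
  haveI := isProbabilityMeasure_wilsonMeasure (d := (F.P K).d) (L := (F.P K).sitesPerDir 0) ρ hρc (β / 2)
  have hν0 : p.ν ≠ 0 := fun h => by
    have := p.hμν; rw [h] at this; exact (Fin.not_lt_zero _ this).elim
  have hν0' : (0 : Fin (F.P K).d) < p.ν := Fin.pos_iff_ne_zero.2 hν0
  have hreal : ∀ {q q' : Fin (F.P K).d}, (wilsonMeasure (d := (F.P K).d) (L := (F.P K).sitesPerDir 0) ρ (β / 2)).real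
        {V : GaugeConfig (F.P K).d ((F.P K).sitesPerDir 0) (Matrix.specialUnitaryGroup (Fin 2) ℂ) |
          plaquetteHolonomy V x q q' ∈ E} =
      ∫ V, E.indicator (fun _ => (1 : ℝ)) (plaquetteHolonomy V x q q')
        ∂(wilsonMeasure (d := (F.P K).d) (L := (F.P K).sitesPerDir 0) ρ (β / 2)) := by
    intro q q'
    have hset : {V : GaugeConfig (F.P K).d ((F.P K).sitesPerDir 0) (Matrix.specialUnitaryGroup (Fin 2) ℂ) |
          plaquetteHolonomy V x q q' ∈ E} =
        (fun V : GaugeConfig (F.P K).d ((F.P K).sitesPerDir 0) (Matrix.specialUnitaryGroup (Fin 2) ℂ) =>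
          plaquetteHolonomy V x q q') ⁻¹' E := rfl
    rw [hset, ← integral_indicator_one ((measurable_plaquetteHolonomy x q q') hEm)]
    refine integral_congr_ae (Filter.Eventually.of_forall fun V => ?_)
    show ((fun W : GaugeConfig (F.P K).d ((F.P K).sitesPerDir 0) (Matrix.specialUnitaryGroup (Fin 2) ℂ) =>
        plaquetteHolonomy W x q q') ⁻¹' E).indicator (fun _ => (1 : ℝ)) V =
      E.indicator (fun _ => (1 : ℝ)) (plaquetteHolonomy V x q q')
    by_cases hV : plaquetteHolonomy V x q q' ∈ E
    · rw [Set.indicator_of_mem hV, Set.indicator_of_mem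
        (show V ∈ (fun W : GaugeConfig (F.P K).d ((F.P K).sitesPerDir 0) (Matrix.specialUnitaryGroup (Fin 2) ℂ) =>
          plaquetteHolonomy W x q q') ⁻¹' E from hV)]
    · rw [Set.indicator_of_notMem hV, Set.indicator_of_notMem
        (show V ∉ (fun W : GaugeConfig (F.P K).d ((F.P K).sitesPerDir 0) (Matrix.specialUnitaryGroup (Fin 2) ℂ) =>
          plaquetteHolonomy W x q q') ⁻¹' E from hV)]
  rw [hreal, FariaDaVeigaOCarroll2022.integral_plaquette_eq_of_symmetry ρ hρc (β / 2) (fun g => E.indicator (fun _ => (1 : ℝ)) g)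
    x x (ne_of_lt p.hμν) hν0, ← hreal]
  -- the prefactor-free tail of the reference orientation (`GaugeConfig 3 n`, `P.d = 3` definitionally)
  have hev : {V : GaugeConfig (F.P K).d ((F.P K).sitesPerDir 0) (Matrix.specialUnitaryGroup (Fin 2) ℂ) |
        plaquetteHolonomy V x 0 p.ν ∈ E} =
      {V : GaugeConfig 3 ((F.P K).sitesPerDir 0) (Matrix.specialUnitaryGroup (Fin 2) ℂ) |
        θ ≤ ‖(fundamentalRep (Fin 2)) (plaquetteHolonomy V x 0 p.ν) - 1‖} := by
    ext V; rfl
  rw [hev]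
  exact hGT ((F.P K).sitesPerDir 0) (one_lt_sitesPerDir F K) (even_sitesPerDir (F.P K) 0) (β / 2) lam hlam0 hlam1 hβ2
    p.ν hν0' x θ hθ

/-- ★★ **THE SAME FOR THE TOWER LAWS `gibbsK`** (`β := β_K = (F.scheme ℰ γ).β K`; `gibbsK_eq`): for every `T3Family F`, small-loop
average `ℰ`, `γ`, cut-off `K`, `0 ≤ λ < 1` with `2 ≤ (1 − λ)·β_K`, `θ ≥ 0` and plaquette `p` of `T^{(0)}_K`,
`(gibbsK F ℰ γ K).real {U | θ ≤ dist1 U(∂p)} ≤ C·((1−λ)⁻¹)³·(β_K∕2)^{3(n²+n+1)∕(2n³)}·exp(−(λ·(β_K∕2)·θ²∕2))` — the twin of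
✓`T3FinestHeightTail.gibbsK_real_not_plaqSmall_le`'s per-plaquette term with `(√β_K)⁹` replaced by `(β_K∕2)^{≤ 9∕(2n)}`.
[cite: Chatterjee2016, Thm. 2.1; Balaban1985UV3, (7) p.257 and (71) p.273] -/
theorem exists_gibbsK_real_dist1_ge_le :
    ∃ C : ℝ, 0 < C ∧ ∀ (F : T3Family) (ℰ : LoopAverage (Matrix.specialUnitaryGroup (Fin 2) ℂ)) (γ : ℝ) (K : ℕ) (lam : ℝ),
      0 ≤ lam → lam < 1 → 2 ≤ (1 - lam) * (F.scheme ℰ γ).β K → ∀ (θ : ℝ), 0 ≤ θ → ∀ p : Plaq (F.P K) 0,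
        (gibbsK F ℰ γ K).real
            {U : GaugeField (F.P K) 0 (Matrix.specialUnitaryGroup (Fin 2) ℂ) | θ ≤ dist1 (GaugeField.plaqHol U p)} ≤
          C * ((1 - lam)⁻¹) ^ 3 *
              ((F.scheme ℰ γ).β K / 2) ^ (3 * ((((F.P K).sitesPerDir 0 : ℕ) : ℝ) ^ 2 + ((F.P K).sitesPerDir 0 : ℕ) + 1) /
                (2 * (((F.P K).sitesPerDir 0 : ℕ) : ℝ) ^ 3)) *
            Real.exp (-(lam * ((F.scheme ℰ γ).β K / 2) * θ ^ 2 / 2)) := by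
  obtain ⟨C, hC, h⟩ := exists_gibbsMeasure_real_dist1_ge_le_T3
  refine ⟨C, hC, fun F ℰ γ K lam hlam0 hlam1 hβ θ hθ p => ?_⟩
  rw [gibbsK_eq]
  exact h F K ((F.scheme ℰ γ).β K) lam hlam0 hlam1 hβ θ hθ p

end

end Summit.QuantumFields.YangMills.Theorems.LocalInsertion.ExpMomentSU2T3
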